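import Literature.MathematicalPhysics.QuantumLattice.DWaveSourceCanonicalClassWindowCertificate
import Literature.MathematicalPhysics.QuantumManyBody.StateRelaxationKKTCharged
import HarnessLib

/-!
# CHARGED `kkt` blocks on the CANONICAL class of the pair-sourced model: the unknown chemical potential is
# replaced by a data envelope (canonical caps at the neighbouring densities, a canonical floor at the density)

Topic `Literature/MathematicalPhysics/QuantumLattice` (namespace = path); cell `hubbard-cq`, seat `hubbard-cq-obsth-1`
(row «pinning-field K5 menu nodes with the pinning term»). Companion of `DWaveSourceCanonicalClassWindowCertificate` (number-CONSERVING
ground-state rows on the canonical class, `μ`-free) and of the model-free `QuantumManyBody/StateRelaxationKKTCharged` (charge-graded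
KKT blocks: the unknown `μ` may be replaced by a one-sided bound because `Re ω(gramForm G B) ≥ 0`).

A density-`ρ` minimiser `ω` of `e^{src}_{0,h}` is, for SOME `μ⋆`, a minimiser and a Bratteli–Kishimoto–Robinson ground state of
`Φ − μ⋆n − hP_d` (`exists_isGroundState_hubbardTTPrimeSourced_of_canonicalMinimiser`). For a CHARGED generator family `Bk_b ∈ 𝔄_Λ`
(`N_Λ Bk_b − Bk_b N_Λ = ∓q Bk_b`, `q ≥ 0`: lowering / raising the particle number by `q`) the ground-state row of `H^{src}(μ⋆) =
H₀ − μ⋆ N` reads, on the `μ = 0` window Hamiltonian `H₀ = pairSourceWindowHamiltonianTT' dWaveFormFactor Λ' t' U 0 h` of the canonical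
certificates, `∓ μ⋆ q · Re ω(gramForm G B̃k) ≤ Re ω(kktForm H₀ G B̃k)`, so with an UPPER bound `μ⋆ ≤ μ̄` (lowering) resp. a LOWER bound
`μ_ ≤ μ⋆` (raising) the usable rows are `0 ≤ Re ω(kktForm H₀ G B̃k) + q μ̄ Re ω(gramForm G B̃k)` resp. `… − q μ_ Re ω(gramForm G B̃k)`.
The ENVELOPE comes from the cell's own node shapes (§3): the minimising property of `ω` for `Φ − μ⋆n − hP_d` against a canonical CAP
state at density `ρ + δ` («`∃ σ TI, ρ(σ) = ρ + δ, e^{src}_{0,h}(σ) ≤ uP`», p2's `exists_canonicalClass_sourced_le_…` shape) and a canonical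
FLOOR at `ρ` («`∀ σ TI, ρ(σ) = ρ → ℓ ≤ e^{src}_{0,h}(σ)`», the E-leg shape) give `μ⋆ ≤ (uP − ℓ)/δ`; a cap at `ρ − δ` gives
`(ℓ − uM)/δ ≤ μ⋆`.

* §1 window bookkeeping: `H^{src}_{Λ'}(μ) = H^{src}_{Λ'}(0) − μ • N_{Λ'}`; a word of definite charge in `𝔄_Λ` has the same charge in `𝔄_{Λ'}`.
* §2 `IsGroundState.re_expect_kktForm_add_mul_nonneg_of_chargeLowering / _sub_mul_nonneg_of_chargeRaising` — the envelope rows for a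
  ground state of `Φ − μ⋆n − hP_d` given `μ⋆ ≤ μ̄` resp. `μ_ ≤ μ⋆`.
* §3 `IsMeanEnergyMinimiser.chemicalPotential_le_div / div_le_chemicalPotential` — the data envelope.
* §4 `canonicalMinimiser_re_expect_kktForm_add_mul_nonneg_of_chargeLowering / _sub_mul_nonneg_of_chargeRaising` — the rows a
  canonical K-leg may carry for its charged blocks (pair words: `q = 2`; `c / c†`: `q = 1`; each block of ONE charge — a Nambu-MIXED
  block of `c` and `c†` together has no common charge and is NOT covered).

HONEST FRAMING (cell hubbard-cq): soundness rows; no certificate, no number, no order parameter, no phase word. The envelope is only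
as tight as the canonical caps/floors at `ρ ± δ` (with the cell's `δ`-grid it is wide); charged `eom` rows stay unlicensed on the
canonical class (they read `ω([H₀, C]) = −μ⋆ q ω(C)` with `ω(C) ≠ 0` in the sourced state). Everything is PROVED; no definition, no
named fact, no `sorry`. Tree search: `lean search 'chargeLowering|chemicalPotential_le_div'` — only the model-free / torus instances;
REUSED `re_map_kktForm_add_mul_nonneg_of_chargeLowering`, `…_of_chargeRaising`, `totalNumber_eq_fermionEmbed_add_sum`,
`commute_outsideNumber_fermionEmbed`, `exists_isGroundState_hubbardTTPrimeSourced_of_canonicalMinimiser`, `meanEnergy_hubbardTTPrimeSourced`.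

References: O. Bratteli, D. W. Robinson, *OAQSM 2* (1997) Prop. 5.3.19 (ground states of the gauge-modified dynamics)
[cite: BratteliRobinsonII1997, Prop. 5.3.19]; O. Bratteli, A. Kishimoto, D. W. Robinson, CMP 64 (1978) 41, Thm. 2
[cite: BratteliKishimotoRobinson1978, Thm. 2]; D. Ruelle, *Statistical Mechanics* (1969) §3.4 (tangents, chemical potential)
[cite: Ruelle1969, §3.4]; M. Araújo et al., arXiv:2311.18707 §3.2 Prop. 11 [cite: AraujoEtAl2023, §3.2 Prop. 11]; T. Koma, H. Tasaki,
J. Stat. Phys. 76 (1994) 745 §1 [cite: KomaTasaki1994, §1].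
-/

noncomputable section

namespace Literature.MathematicalPhysics.QuantumLattice

open Matrix Finset Complex HubbardWave0 Literature.Probability.LatticeModels Set
open Literature.MathematicalPhysics.QuantumManyBody.StateRelaxation
open scoped ComplexOrder BigOperators

/-! ## §1 Window bookkeeping -/

section Window

variable {Λ Λ' : Finset (Site 2)}

/-- **`H^{src}_{Λ'}(μ) = H^{src}_{Λ'}(0) − μ • N_{Λ'}`**: the chemical-potential term of the window Hamiltonian is the window particle
number. [cite: KomaTasaki1994, §1] -/
theorem pairSourceWindowHamiltonianTT'_eq_zero_sub_smul_totalNumber (g : Site 2 → ℝ) (Λ' : Finset (Site 2)) (tp U μ h : ℝ) :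
    pairSourceWindowHamiltonianTT' g Λ' tp U μ h =
      pairSourceWindowHamiltonianTT' g Λ' tp U 0 h - (μ : ℂ) • (totalNumber : FermionOp Λ') := by
  rw [pairSourceWindowHamiltonianTT'_eq, pairSourceWindowHamiltonianTT'_eq]
  push_cast
  rw [zero_smul, sub_zero]
  abel

/-- **A word of definite charge keeps its charge in every larger window**: if `N_Λ B − B N_Λ = c • B` then
`N_{Λ'} B̃ − B̃ N_{Λ'} = c • B̃` (`N_{Λ'} = Γ N_Λ + N_{Λ'∖Λ}`, the outside number commuting with `𝔄_Λ`).
[cite: BratteliRobinsonII1997, §6.2.4] -/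
theorem totalNumber_commutator_fermionEmbed_incl_of_commutator (hΛ : Λ ⊆ Λ') {B : FermionOp Λ} {c : ℂ}
    (hB : (totalNumber : FermionOp Λ) * B - B * totalNumber = c • B) :
    (totalNumber : FermionOp Λ') * fermionEmbed (PolySite.incl hΛ) B - fermionEmbed (PolySite.incl hΛ) B * totalNumber =
      c • fermionEmbed (PolySite.incl hΛ) B := by
  have hout := (commute_outsideNumber_fermionEmbed hΛ B).eq
  rw [totalNumber_eq_fermionEmbed_add_sum hΛ, add_mul, mul_add, hout, ← map_mul, ← map_mul]
  rw [show fermionEmbed (PolySite.incl hΛ) (totalNumber * B) = fermionEmbed (PolySite.incl hΛ) (B * totalNumber) +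
      c • fermionEmbed (PolySite.incl hΛ) B by rw [← map_smul, ← map_add, ← hB, add_sub_cancel]]
  abel

end Window

/-! ## §2 The envelope rows for a ground state at chemical potential `μ⋆` -/

namespace InfVolFermionState

variable {ω : InfVolFermionState 2} {t' U μs h : ℝ} {Λ Λ' : Finset (Site 2)}

/-- The ground-state inequality of `Φ − μ⋆n − hP_d` on the span of an embedded generator family, in the `H₀ − μ⋆ • N` spelling of the
model-free charged-KKT file. [cite: BratteliKishimotoRobinson1978, §1 (definition of τ-ground state)] -/
theorem IsGroundState.re_expect_span_commutator_sub_smul_totalNumber_nonneg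
    (hgs : ω.IsGroundState (hubbardTTPrimeSourcedInteraction 1 t' U μs dWaveFormFactor h) 1)
    (hΛ : Λ ⊆ Λ') (h8 : thicken Λ 1 ⊆ Λ') {β : Type*} [Fintype β] [DecidableEq β] (Bk : β → FermionOp Λ) (w : β → ℂ) :
    0 ≤ (ω.expect Λ' (star (∑ j, w j • fermionEmbed (PolySite.incl hΛ) (Bk j)) *
      ((pairSourceWindowHamiltonianTT' dWaveFormFactor Λ' t' U 0 h - (μs : ℂ) • (totalNumber : FermionOp Λ')) *
          (∑ j, w j • fermionEmbed (PolySite.incl hΛ) (Bk j)) -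
        (∑ j, w j • fermionEmbed (PolySite.incl hΛ) (Bk j)) *
          (pairSourceWindowHamiltonianTT' dWaveFormFactor Λ' t' U 0 h - (μs : ℂ) • (totalNumber : FermionOp Λ'))))).re := by
  have hsum : ∑ j, w j • fermionEmbed (PolySite.incl hΛ) (Bk j) = fermionEmbed (PolySite.incl hΛ) (∑ j, w j • Bk j) := by
    rw [map_sum]
    exact Finset.sum_congr rfl fun j _ => (fermionEmbed_smul _ _ _).symm
  rw [hsum, Matrix.star_eq_conjTranspose, ← pairSourceWindowHamiltonianTT'_eq_zero_sub_smul_totalNumber]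
  exact hgs.re_expect_conj_commutator_pairSourceWindowHamiltonianTT'_nonneg hΛ h8 _

/-- **Charged `kkt` block, LOWERING family, envelope form**: for a ground state `ω` of `Φ − μ⋆n − hP_d` with `μ⋆ ≤ μ̄`, a generator
family `Bk_b ∈ 𝔄_Λ` lowering the particle number by `q ≥ 0` (`N_Λ Bk_b − Bk_b N_Λ = −q Bk_b`; e.g. singlet pair annihilators, `q = 2`),
`G ⪰ 0` and `thicken Λ 1 ⊆ Λ'`: `0 ≤ Re ω(kktForm H₀ G B̃k) + q μ̄ Re ω(gramForm G B̃k)`, `H₀` the `μ = 0` window Hamiltonian.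
[cite: BratteliRobinsonII1997, Prop. 5.3.19] [cite: AraujoEtAl2023, §3.2 Prop. 11] -/
theorem IsGroundState.re_expect_kktForm_add_mul_nonneg_of_chargeLowering
    (hgs : ω.IsGroundState (hubbardTTPrimeSourcedInteraction 1 t' U μs dWaveFormFactor h) 1) {μup q : ℝ} (hμ : μs ≤ μup)
    (hq : 0 ≤ q) (hΛ : Λ ⊆ Λ') (h8 : thicken Λ 1 ⊆ Λ') {β : Type*} [Fintype β] [DecidableEq β] {G : Matrix β β ℂ}
    (hG : G.PosSemidef) (Bk : β → FermionOp Λ) (hBk : ∀ b, (totalNumber : FermionOp Λ) * Bk b - Bk b * totalNumber = -((q : ℂ) • Bk b)) :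
    0 ≤ (ω.expect Λ' (kktForm (pairSourceWindowHamiltonianTT' dWaveFormFactor Λ' t' U 0 h) G
        (fun b => fermionEmbed (PolySite.incl hΛ) (Bk b)))).re +
      q * μup * (ω.expect Λ' (gramForm G (fun b => fermionEmbed (PolySite.incl hΛ) (Bk b)))).re := by
  have hpos : ∀ A : FermionOp Λ', 0 ≤ ω.expect Λ' (star A * A) := fun A => by
    rw [Matrix.star_eq_conjTranspose]; exact ω.expect_nonneg Λ' A
  refine re_map_kktForm_add_mul_nonneg_of_chargeLowering (ω.expect Λ') hpos _ (totalNumber : FermionOp Λ') hμ hq hG _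
    (fun b => ?_) (fun w => hgs.re_expect_span_commutator_sub_smul_totalNumber_nonneg hΛ h8 Bk w)
  have hBk' : (totalNumber : FermionOp Λ) * Bk b - Bk b * totalNumber = (-(q : ℂ)) • Bk b := by rw [hBk b, neg_smul]
  rw [totalNumber_commutator_fermionEmbed_incl_of_commutator hΛ hBk', neg_smul]

/-- **Charged `kkt` block, RAISING family, envelope form**: for a ground state `ω` of `Φ − μ⋆n − hP_d` with `μ_ ≤ μ⋆`, a family raising
the particle number by `q ≥ 0` (`N_Λ Bk_b − Bk_b N_Λ = q Bk_b`), `G ⪰ 0`: `0 ≤ Re ω(kktForm H₀ G B̃k) − q μ_ Re ω(gramForm G B̃k)`.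
[cite: BratteliRobinsonII1997, Prop. 5.3.19] [cite: AraujoEtAl2023, §3.2 Prop. 11] -/
theorem IsGroundState.re_expect_kktForm_sub_mul_nonneg_of_chargeRaising
    (hgs : ω.IsGroundState (hubbardTTPrimeSourcedInteraction 1 t' U μs dWaveFormFactor h) 1) {μlow q : ℝ} (hμ : μlow ≤ μs)
    (hq : 0 ≤ q) (hΛ : Λ ⊆ Λ') (h8 : thicken Λ 1 ⊆ Λ') {β : Type*} [Fintype β] [DecidableEq β] {G : Matrix β β ℂ}
    (hG : G.PosSemidef) (Bk : β → FermionOp Λ) (hBk : ∀ b, (totalNumber : FermionOp Λ) * Bk b - Bk b * totalNumber = (q : ℂ) • Bk b) :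
    0 ≤ (ω.expect Λ' (kktForm (pairSourceWindowHamiltonianTT' dWaveFormFactor Λ' t' U 0 h) G
        (fun b => fermionEmbed (PolySite.incl hΛ) (Bk b)))).re -
      q * μlow * (ω.expect Λ' (gramForm G (fun b => fermionEmbed (PolySite.incl hΛ) (Bk b)))).re := by
  have hpos : ∀ A : FermionOp Λ', 0 ≤ ω.expect Λ' (star A * A) := fun A => by
    rw [Matrix.star_eq_conjTranspose]; exact ω.expect_nonneg Λ' A
  exact re_map_kktForm_sub_mul_nonneg_of_chargeRaising (ω.expect Λ') hpos _ (totalNumber : FermionOp Λ') hμ hq hG _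
    (fun b => totalNumber_commutator_fermionEmbed_incl_of_commutator hΛ (hBk b))
    (fun w => hgs.re_expect_span_commutator_sub_smul_totalNumber_nonneg hΛ h8 Bk w)

/-! ## §3 The chemical-potential envelope of a canonical minimiser from the cell's node shapes -/

/-- **Upper envelope**: if `ω` minimises the mean energy of `Φ − μ⋆n − hP_d` among translation-invariant states, `ℓ ≤ e^{src}_{0,h}(ω)`, and
some translation-invariant `σ₊` of density `ρ(ω) + δ` (`δ > 0`) has `e^{src}_{0,h}(σ₊) ≤ uP`, then `μ⋆ ≤ (uP − ℓ)/δ` (the minimising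
inequality against `σ₊`: `e₀(ω) − μ⋆ρ ≤ e₀(σ₊) − μ⋆(ρ + δ)`). [cite: Ruelle1969, §3.4] -/
theorem IsMeanEnergyMinimiser.chemicalPotential_le_div
    (hmin : ω.IsMeanEnergyMinimiser (hubbardTTPrimeSourcedInteraction 1 t' U μs dWaveFormFactor h) 1) {ℓ uP δ : ℝ} (hδ : 0 < δ)
    (hℓ : ℓ ≤ ω.meanEnergy (hubbardTTPrimeSourcedInteraction 1 t' U 0 dWaveFormFactor h) 1)
    (hcap : ∃ σ : InfVolFermionState 2, σ.IsTranslationInvariant ∧ σ.density = ω.density + δ ∧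
      σ.meanEnergy (hubbardTTPrimeSourcedInteraction 1 t' U 0 dWaveFormFactor h) 1 ≤ uP) :
    μs ≤ (uP - ℓ) / δ := by
  obtain ⟨σ, hσ, hσρ, hσu⟩ := hcap
  have hle := hmin.2 σ hσ
  rw [meanEnergy_hubbardTTPrimeSourced, meanEnergy_hubbardTTPrimeSourced] at hle
  rw [meanEnergy_hubbardTTPrimeSourced] at hℓ hσu
  rw [le_div_iff₀ hδ, hσρ] at *
  nlinarith [hle, hℓ, hσu, hσρ]

/-- **Lower envelope**: a translation-invariant `σ₋` of density `ρ(ω) − δ` (`δ > 0`) with `e^{src}_{0,h}(σ₋) ≤ uM` and `ℓ ≤ e^{src}_{0,h}(ω)`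
give `(ℓ − uM)/δ ≤ μ⋆`. [cite: Ruelle1969, §3.4] -/
theorem IsMeanEnergyMinimiser.div_le_chemicalPotential
    (hmin : ω.IsMeanEnergyMinimiser (hubbardTTPrimeSourcedInteraction 1 t' U μs dWaveFormFactor h) 1) {ℓ uM δ : ℝ} (hδ : 0 < δ)
    (hℓ : ℓ ≤ ω.meanEnergy (hubbardTTPrimeSourcedInteraction 1 t' U 0 dWaveFormFactor h) 1)
    (hcap : ∃ σ : InfVolFermionState 2, σ.IsTranslationInvariant ∧ σ.density = ω.density - δ ∧
      σ.meanEnergy (hubbardTTPrimeSourcedInteraction 1 t' U 0 dWaveFormFactor h) 1 ≤ uM) :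
    (ℓ - uM) / δ ≤ μs := by
  obtain ⟨σ, hσ, hσρ, hσu⟩ := hcap
  have hle := hmin.2 σ hσ
  rw [meanEnergy_hubbardTTPrimeSourced, meanEnergy_hubbardTTPrimeSourced] at hle
  rw [meanEnergy_hubbardTTPrimeSourced] at hℓ hσu
  rw [div_le_iff₀ hδ, hσρ] at *
  nlinarith [hle, hℓ, hσu, hσρ]

/-! ## §4 The rows a canonical K-leg may carry for its charged blocks -/

variable {ρ : ℝ}

/-- **CANONICAL CLASS, charge-LOWERING block**: for a density-`ρ` minimiser `ω` of `e^{src}_{0,h}` (`0 < ρ < 2`), a canonical FLOOR on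
the class («`∀ σ TI, ρ(σ) = ρ → ℓ ≤ e^{src}_{0,h}(σ)`», the E-leg shape), a canonical CAP at density `ρ + δ`
(«`∃ σ TI, ρ(σ) = ρ + δ, e^{src}_{0,h}(σ) ≤ uP`», `δ > 0`), a family `Bk_b ∈ 𝔄_Λ` lowering the particle number by `q ≥ 0`, `G ⪰ 0`,
`thicken Λ 1 ⊆ Λ'`: `0 ≤ Re ω(kktForm H₀ G B̃k) + q ((uP − ℓ)/δ) Re ω(gramForm G B̃k)`. [cite: BratteliKishimotoRobinson1978, Thm. 2]
[cite: Ruelle1969, §3.4] [cite: BratteliRobinsonII1997, Prop. 5.3.19] -/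
theorem canonicalMinimiser_re_expect_kktForm_add_mul_nonneg_of_chargeLowering (hω : ω.IsTranslationInvariant)
    (hρ : ω.density = ρ) (hρ0 : 0 < ρ) (hρ2 : ρ < 2)
    (hmin : ∀ σ : InfVolFermionState 2, σ.IsTranslationInvariant → σ.density = ρ →
      ω.meanEnergy (hubbardTTPrimeSourcedInteraction 1 t' U 0 dWaveFormFactor h) 1 ≤
        σ.meanEnergy (hubbardTTPrimeSourcedInteraction 1 t' U 0 dWaveFormFactor h) 1)
    {ℓ uP δ q : ℝ} (hδ : 0 < δ) (hq : 0 ≤ q)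
    (hfloor : ∀ σ : InfVolFermionState 2, σ.IsTranslationInvariant → σ.density = ρ →
      ℓ ≤ σ.meanEnergy (hubbardTTPrimeSourcedInteraction 1 t' U 0 dWaveFormFactor h) 1)
    (hcap : ∃ σ : InfVolFermionState 2, σ.IsTranslationInvariant ∧ σ.density = ρ + δ ∧
      σ.meanEnergy (hubbardTTPrimeSourcedInteraction 1 t' U 0 dWaveFormFactor h) 1 ≤ uP)
    (hΛ : Λ ⊆ Λ') (h8 : thicken Λ 1 ⊆ Λ') {β : Type*} [Fintype β] [DecidableEq β] {G : Matrix β β ℂ} (hG : G.PosSemidef)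
    (Bk : β → FermionOp Λ) (hBk : ∀ b, (totalNumber : FermionOp Λ) * Bk b - Bk b * totalNumber = -((q : ℂ) • Bk b)) :
    0 ≤ (ω.expect Λ' (kktForm (pairSourceWindowHamiltonianTT' dWaveFormFactor Λ' t' U 0 h) G
        (fun b => fermionEmbed (PolySite.incl hΛ) (Bk b)))).re +
      q * ((uP - ℓ) / δ) * (ω.expect Λ' (gramForm G (fun b => fermionEmbed (PolySite.incl hΛ) (Bk b)))).re := by
  obtain ⟨μs, hms, hgs⟩ := exists_isGroundState_hubbardTTPrimeSourced_of_canonicalMinimiser hω hρ hρ0 hρ2 hmin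
  have hμ : μs ≤ (uP - ℓ) / δ :=
    hms.chemicalPotential_le_div hδ (hfloor ω hω hρ) (by rw [hρ]; exact hcap)
  exact hgs.re_expect_kktForm_add_mul_nonneg_of_chargeLowering hμ hq hΛ h8 hG Bk hBk

/-- **CANONICAL CLASS, charge-RAISING block**: with a canonical CAP at density `ρ − δ` («`∃ σ TI, ρ(σ) = ρ − δ, e^{src}_{0,h}(σ) ≤ uM`»)
instead, a family raising the particle number by `q ≥ 0` obeys `0 ≤ Re ω(kktForm H₀ G B̃k) − q ((ℓ − uM)/δ) Re ω(gramForm G B̃k)`.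
[cite: BratteliKishimotoRobinson1978, Thm. 2] [cite: Ruelle1969, §3.4] [cite: BratteliRobinsonII1997, Prop. 5.3.19] -/
theorem canonicalMinimiser_re_expect_kktForm_sub_mul_nonneg_of_chargeRaising (hω : ω.IsTranslationInvariant)
    (hρ : ω.density = ρ) (hρ0 : 0 < ρ) (hρ2 : ρ < 2)
    (hmin : ∀ σ : InfVolFermionState 2, σ.IsTranslationInvariant → σ.density = ρ →
      ω.meanEnergy (hubbardTTPrimeSourcedInteraction 1 t' U 0 dWaveFormFactor h) 1 ≤
        σ.meanEnergy (hubbardTTPrimeSourcedInteraction 1 t' U 0 dWaveFormFactor h) 1)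
    {ℓ uM δ q : ℝ} (hδ : 0 < δ) (hq : 0 ≤ q)
    (hfloor : ∀ σ : InfVolFermionState 2, σ.IsTranslationInvariant → σ.density = ρ →
      ℓ ≤ σ.meanEnergy (hubbardTTPrimeSourcedInteraction 1 t' U 0 dWaveFormFactor h) 1)
    (hcap : ∃ σ : InfVolFermionState 2, σ.IsTranslationInvariant ∧ σ.density = ρ - δ ∧
      σ.meanEnergy (hubbardTTPrimeSourcedInteraction 1 t' U 0 dWaveFormFactor h) 1 ≤ uM)
    (hΛ : Λ ⊆ Λ') (h8 : thicken Λ 1 ⊆ Λ') {β : Type*} [Fintype β] [DecidableEq β] {G : Matrix β β ℂ} (hG : G.PosSemidef)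
    (Bk : β → FermionOp Λ) (hBk : ∀ b, (totalNumber : FermionOp Λ) * Bk b - Bk b * totalNumber = (q : ℂ) • Bk b) :
    0 ≤ (ω.expect Λ' (kktForm (pairSourceWindowHamiltonianTT' dWaveFormFactor Λ' t' U 0 h) G
        (fun b => fermionEmbed (PolySite.incl hΛ) (Bk b)))).re -
      q * ((ℓ - uM) / δ) * (ω.expect Λ' (gramForm G (fun b => fermionEmbed (PolySite.incl hΛ) (Bk b)))).re := by
  obtain ⟨μs, hms, hgs⟩ := exists_isGroundState_hubbardTTPrimeSourced_of_canonicalMinimiser hω hρ hρ0 hρ2 hmin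
  have hμ : (ℓ - uM) / δ ≤ μs :=
    hms.div_le_chemicalPotential hδ (hfloor ω hω hρ) (by rw [hρ]; exact hcap)
  exact hgs.re_expect_kktForm_sub_mul_nonneg_of_chargeRaising hμ hq hΛ h8 hG Bk hBk

end InfVolFermionState

end Literature.MathematicalPhysics.QuantumLattice

end
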